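import Summits.CriticalPhenomena.PercolationContinuityZ3.Theorems.PercExchangeRateTransportCriticalCurveRegular
import Summits.CriticalPhenomena.PercolationContinuityZ3.Theorems.PercExchangeRateTransportModelFacts

/-!
# F3 WITNESS for the rung `IsoShelfNull` — line `iso_shelf_null` (fwd-rung G1 gen 5 over `CriticalCurveRegular`;
# crux K⁻ `SubcritExchangeUniformity`, stmt-CriticalPhenomena-16062; route `PercExchangeRateTransport`)

The rung is the `T = univ` member of the graded family `ShelfNullBelow T` := (floor `CriticalCurveRegular`) ∧
(∀ t ∈ T ∩ (0,1), t < p₃ := p_c(ℤ³) → θ(p₃, t) = 0).  Specialising the parameter to `T := ∅` gives a statement that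
is literally the proved floor: the `example` below is `by simpa using <floor>` from the seed
`Cruxes.CriticalCurveRegular.Locmod.CriticalCurveRegular_proof` (item 16065), and `shelfNullBelow_empty_iff` records
`ShelfNullBelow ∅ ↔ CriticalCurveRegular`.
witness_regime: the label-coupled anisotropic bond family on `ℤ²×ℤ`, every level `t ∈ (0,1)`; `θ(p_c) = 0` is NOT
known anywhere on this family (at `t = p₃` it is the sub-problem statement itself), and the shelf clause at
`T = univ` is not a consequence of the floor (forward kernel: `floor_implies_rung` does not close; real_step = true).
Self-contained copy of the family (verbatim the `def`s of `Lines/iso_shelf_null.lean`, separate namespace).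
-/

namespace Summit.CriticalPhenomena.PercolationContinuityZ3.Cruxes.SubcritExchangeUniformity.IsoShelf.Special

open Summit.CriticalPhenomena.PercolationContinuityZ3.Theses.PercExchangeRateTransport

/-- Verbatim copy of `IsoShelf.ShelfNullBelow` (self-contained witness file). -/
def ShelfNullBelow (T : Set ℝ) : Prop :=
  let μ := Literature.Probability.Percolation.labelMeasure (Literature.Probability.LatticeModels.Site 3); let vert : Sym2 (Literature.Probability.LatticeModels.Site 3) → Prop := fun e => ∃ x : Literature.Probability.LatticeModels.Site 3, e = s(x, x + Pi.single (2 : Fin 3) 1); let cfg : ℝ → ℝ → (Sym2 (Literature.Probability.LatticeModels.Site 3) → ℝ) → Set (Sym2 (Literature.Probability.LatticeModels.Site 3)) := fun p t U => {e | e ∈ (Literature.Probability.LatticeModels.zdGraph 3).edgeSet ∧ ((vert e ∧ U e ≤ t) ∨ (¬ vert e ∧ U e ≤ p))}; let θ : ℝ → ℝ → ℝ := fun p t => μ.real {U | cfg p t U ∈ Literature.Probability.Percolation.percolatesAt (0 : Literature.Probability.LatticeModels.Site 3)}; let pc : ℝ → ℝ := fun t => sInf ({p : ℝ | 0 ≤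 p ∧ p ≤ 1 ∧ 0 < θ p t} ∪ {1}); (ContinuousOn pc (Set.Ioo 0 1) ∧ ∀ t ∈ Set.Ioo (0 : ℝ) 1, 0 < pc t ∧ pc t < 1) ∧ ∀ t ∈ T, t ∈ Set.Ioo (0 : ℝ) 1 → t < Literature.Probability.Percolation.criticalProb (Literature.Probability.LatticeModels.zdGraph 3) (0 : Literature.Probability.LatticeModels.Site 3) → θ (Literature.Probability.Percolation.criticalProb (Literature.Probability.LatticeModels.zdGraph 3) (0 : Literature.Probability.LatticeModels.Site 3)) t = 0

/-- Verbatim copy of `IsoShelf.IsoShelfNull`: the rung, `T = univ`. -/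
def IsoShelfNull : Prop := ShelfNullBelow Set.univ

/-- **F3 witness: the floor is the `T = ∅` instance of the family**, by `simpa` from the seed. -/
example : ShelfNullBelow ∅ := by
  simpa [ShelfNullBelow, CriticalCurveRegular] using
    Summit.CriticalPhenomena.PercolationContinuityZ3.Cruxes.CriticalCurveRegular.Locmod.CriticalCurveRegular_proof

/-- The same as a named theorem with a two-line term. -/
theorem shelfNullBelow_floor : ShelfNullBelow ∅ := by
  unfold ShelfNullBelow
  exact ⟨Summit.CriticalPhenomena.PercolationContinuityZ3.Cruxes.CriticalCurveRegular.Locmod.CriticalCurveRegular_proof,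
    fun t ht _ _ => (Set.notMem_empty t ht).elim⟩

/-- … and the floor is literally the `T = ∅` member (both directions). -/
theorem shelfNullBelow_empty_iff : ShelfNullBelow ∅ ↔ CriticalCurveRegular := by
  unfold ShelfNullBelow CriticalCurveRegular
  exact ⟨fun h => h.1, fun h => ⟨h, fun t ht _ _ => (Set.notMem_empty t ht).elim⟩⟩

/-- The family is antitone in `T`; in particular the rung hands back the floor. -/
theorem shelfNullBelow_mono {T T' : Set ℝ} (h : T ⊆ T') : ShelfNullBelow T' → ShelfNullBelow T := by
  unfold ShelfNullBelow
  intro h'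
  exact ⟨h'.1, fun t ht => h'.2 t (h ht)⟩

theorem floor_of_rung : IsoShelfNull → CriticalCurveRegular := fun h =>
  shelfNullBelow_empty_iff.1 (shelfNullBelow_mono (Set.empty_subset _) h)

end Summit.CriticalPhenomena.PercolationContinuityZ3.Cruxes.SubcritExchangeUniformity.IsoShelf.Special
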